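import Summits.RiemannHypothesis.RiemannHypothesis.Theorems.WeilTwoPrimeDeflM80PBase
import Summits.RiemannHypothesis.RiemannHypothesis.Theorems.WeilTwoPrimeDeflM80PDataDnE18
import Literature.NumberTheory.LFunctions.WeilBlockRowsPZ
import HarnessLib

/-!
# Even-sector deflated two-prime certificate M80P: the factored even inverse agrees with `D`, rows 124–127

`WeilCert.checkDnRow` (even block) for certificate M80P, by `decide +kernel`. Pure proof file.
-/

set_option linter.dupNamespace false

noncomputable section

namespace Summit.RiemannHypothesis.RiemannHypothesis.Theorems.EvenWinsBeyondArch

open Literature.NumberTheory.LFunctions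

set_option maxHeartbeats 0 in
/-- Row 124 of `DnE/LsE` is row 124 of the even `D` (certificate M80P). [folklore] -/
theorem checkDnRow0_124_weilCertDeflM80P : weilCertDeflM80PBase.checkDnRow weilCertDeflM80PDnE weilCertDeflM80PLsE 0 124 = true := by
  decide +kernel

set_option maxHeartbeats 0 in
/-- Row 125 of `DnE/LsE` is row 125 of the even `D` (certificate M80P). [folklore] -/
theorem checkDnRow0_125_weilCertDeflM80P : weilCertDeflM80PBase.checkDnRow weilCertDeflM80PDnE weilCertDeflM80PLsE 0 125 = true := by
  decide +kernel

set_option maxHeartbeats 0 in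
/-- Row 126 of `DnE/LsE` is row 126 of the even `D` (certificate M80P). [folklore] -/
theorem checkDnRow0_126_weilCertDeflM80P : weilCertDeflM80PBase.checkDnRow weilCertDeflM80PDnE weilCertDeflM80PLsE 0 126 = true := by
  decide +kernel

set_option maxHeartbeats 0 in
/-- Row 127 of `DnE/LsE` is row 127 of the even `D` (certificate M80P). [folklore] -/
theorem checkDnRow0_127_weilCertDeflM80P : weilCertDeflM80PBase.checkDnRow weilCertDeflM80PDnE weilCertDeflM80PLsE 0 127 = true := by
  decide +kernel


end Summit.RiemannHypothesis.RiemannHypothesis.Theorems.EvenWinsBeyondArch
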